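import Summits.CriticalPhenomena.Ising3DConformalLimit.Theses.LeeYangGap
import Summits.CriticalPhenomena.Ising3DConformalLimit.Theses.ArmHyperscaling
import Literature.Probability.LatticeModels.LeeYangFirstZeroLimit
import Literature.Probability.LatticeModels.ConformalCovariance

/-!
# Strategy census s9 — typed candidate statements (crux `NearCriticalLeeYangGap`, item 4945)

Signatures only (no proofs, no sorries): the statements discussed in STRATEGY-CENSUS-s9.md,
so that every candidate named there elaborates over existing declarations.
-/

noncomputable section

namespace Summit.CriticalPhenomena.Ising3DConformalLimit.Cruxes.NearCriticalLeeYangGap.CensusS9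

open Filter Finset
open Literature.Probability.LatticeModels

/-- `Σ_L = ⟨M_L²⟩⁺_{β_c}` (block variance at criticality). -/
def blockVar (L : ℕ) : ℝ :=
  plusExpect 3 (criticalBeta 3) 0 (fun σ => (∑ x ∈ box 3 L, spinAt x σ) ^ 2)

/-- `⟨M_L⁴⟩⁺_{β_c}`. -/
def blockFourth (L : ℕ) : ℝ :=
  plusExpect 3 (criticalBeta 3) 0 (fun σ => (∑ x ∈ box 3 L, spinAt x σ) ^ 4)

/-- GAP_c — the critical Binder floor, frequently in `L` (tree: ⟺ the crux, both directions landed). -/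
def BinderFloorFrequently : Prop :=
  ∃ c : ℝ, 0 < c ∧ ∃ᶠ L : ℕ in atTop, c * blockVar L ^ 2 ≤ 3 * blockVar L ^ 2 - blockFourth L

/-! ## Heading 1 — weaker intermediate -/

/-- W1: every non-degenerate MÖBIUS-COVARIANT pointwise scaling limit has `U₄ ≢ 0`
(= item 0636 `IsingEuclidUpgradeR4NonGaussian` weakened by the covariance hypothesis). -/
def CovariantLimitNonGaussian : Prop :=
  ∀ (ρ : ℝ → ℝ) (Δ : ℝ) (S : CorrFamily 3), (∀ δ ∈ Set.Ioc (0:ℝ) 1, 0 < ρ δ) →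
    HasPointwiseScalingLimit (criticalCorr 3) ρ S → IsNondegenerateTwoPoint S →
    IsMoebiusCovariant Δ S → HasNontrivialU4 S

/-- W0: the first Lee–Yang zero of the critical block tends to zero along a subsequence
(KNOWN for free cubes: Jiang–Newman 2023 Thm 1 + Lemma 1; strictly weaker than the crux). -/
def FirstZeroVanishesFrequently : Prop :=
  ∀ ε : ℝ, 0 < ε → ∃ᶠ L : ℕ in atTop, ∃ θ : ℝ, 0 < θ ∧ θ ≤ ε ∧
    plusExpect 3 (criticalBeta 3) 0
      (fun σ => Real.cos (θ * ∑ x ∈ box 3 L, spinAt x σ)) = 0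

/-! ## Heading Strengthen -/

/-- S⁺₁: EVENTUAL Binder floor (`∀ᶠ` for `∃ᶠ`). -/
def BinderFloorEventually : Prop :=
  ∃ c : ℝ, 0 < c ∧ ∀ᶠ L : ℕ in atTop, c * blockVar L ^ 2 ≤ 3 * blockVar L ^ 2 - blockFourth L

/-- S⁺₂: Lee–Yang deficit of the block mgf at UNIT dimensionless field
(`⟨exp(M_L/√Σ_L)⟩ ≤ exp((1-ε)/2)` frequently) — equivalent to GAP_c for each fixed field. -/
def UnitFieldDeficit : Prop :=
  ∃ ε : ℝ, 0 < ε ∧ ∃ᶠ L : ℕ in atTop,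
    plusExpect 3 (criticalBeta 3) 0
        (fun σ => Real.exp ((∑ x ∈ box 3 L, spinAt x σ) / Real.sqrt (blockVar L))) ≤
      Real.exp ((1 - ε) / 2)

/-! ## Heading Decomposition — exponent split (zero slack) and the matched form -/

/-- Sub₁(a): upper critical isotherm with exponent `a` (`m(β_c,h) ≤ C h^a`, i.e. `δ ≤ 1/a`). -/
def UpperIsothermExponent (a : ℝ) : Prop :=
  ∃ C : ℝ, ∀ h : ℝ, 0 < h → h ≤ 1 → magnetizationInField 3 (criticalBeta 3) h ≤ C * h ^ a

/-- Sub₂(a): block-variance growth `Σ_L ≥ c L^{6/(1+a)}` frequently. -/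
def VarianceGrowthExponent (a : ℝ) : Prop :=
  ∃ c : ℝ, 0 < c ∧ ∃ᶠ L : ℕ in atTop, c * (L : ℝ) ^ (6 / (1 + a)) ≤ blockVar L

/-- The exponent split as ONE statement (the shared `a` is the coupling; see census §Decomposition). -/
def MatchedExponents : Prop :=
  ∃ a : ℝ, 0 < a ∧ a < 1 ∧ UpperIsothermExponent a ∧ VarianceGrowthExponent a

/-! ## Heading Transfer — the complex-analytic form of Newman's criterion; by-product rate -/

/-- By-product (Borel–Carathéodory + Cauchy on the Lee–Yang zero-free disc): for the FREE cube,
`α₁(Λ_L, β) · ⟨M_L²⟩^{free}_{Λ_L,β,0} ≤ 16 |Λ_L|` (Jiang–Newman units for `α₁`). Unconditional;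
squares the counting bound `α₁² ⟨M²⟩ ≤ 8|Λ|` of Jiang–Newman (2.17). -/
def FirstZeroCauchyBound : Prop :=
  ∀ (L : ℕ) (β : ℝ), 0 ≤ β →
    JiangNewman.firstZero 3 (box 3 L) β *
        isingExpect (zdGraph 3) (box 3 L) β 0 .free (fun σ => (∑ x ∈ box 3 L, spinAt x σ) ^ 2) ≤
      16 * ((box 3 L).card : ℝ)

/-! ## Heading Negation — the typed obstruction is a barrier, not a lemma -/

/-- The Gaussian scenario ¬GAP_c forces a SUPER-isotherm at the CLT field scale
(landed: `PerfectScreeningCoulombImpliesNontrivial.stub_superIsothermOfVanishingBinder`);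
nothing known contradicts it on ℤ³ (long-range RP models on ℤ³ realise it: LongRangeTrivialityOnZ3). -/
def GaussianScenario : Prop :=
  Tendsto (fun L : ℕ => (3 * blockVar L ^ 2 - blockFourth L) / blockVar L ^ 2) atTop (nhds 0)

/- (The implication `BinderFloorFrequently → ¬ GaussianScenario` needs `0 < blockVar L`, available in
   the tree as `LeeYangGap…` block-package lemmas; both directions GAP ⟺ ¬GaussianScenario are LANDED:
   `PerfectScreeningCoulombImpliesNontrivial.stub_gapOfBinderNonvanishing` and the `GapOfBinder` file.) -/

end Summit.CriticalPhenomena.Ising3DConformalLimit.Cruxes.NearCriticalLeeYangGap.CensusS9
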